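import Literature.AlgebraicTopology.SingularHomology.LocalHomologyVanishing
import HarnessLib

/-!
# Signs of isomorphisms of local homology groups; the sign of a homeomorphism; translations

A. Hatcher, *Algebraic Topology*, CUP 2002, §2.2, p. 134 (degree: "`f_*(α) = d α` … `d` depends only
on `f`"), §3.3, pp. 233–236 (local orientations `μₓ ∈ Hₙ(M | x; ℤ)`, a generator of `≅ ℤ`;
two `ℤ`-orientations of a connected manifold agree or are opposite); G. E. Bredon, *Topology and
Geometry*, GTM 139 (1993), IV.6–IV.7 and VI.7 (local degrees and orientations).

Elementary bookkeeping for *local degrees*, used by the bridge between smooth and homological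
orientations (`Literature/Topology/FourManifolds/SmoothHomologicalOrientation.lean`):

* generators of infinite cyclic groups: an isomorphism of `ℤ`-lines sends a generator to `±` a
  generator (`exists_units_smul_eq_of_linearEquiv`), and the sign is unique
  (`units_eq_of_smul_eq_smul`);
* push-forward of local homology `Hₖ(X | a) ⟶ Hₖ(Y | f a)` along an **open embedding** is an
  isomorphism (`localHomology.isIso_map_of_isOpenEmbedding_of_eq`: a homeomorphism onto an open subset
  followed by excision, Hatcher Thm. 2.20 / §3.3 p. 231);
* a self-homeomorphism `e` of a connected `ℤ`-oriented manifold has a **global sign** `s = ±1`,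
  `e_* μ_p = s • μ_{e p}` for all `p` (`HomologicalOrientation.exists_sign_of_homeomorph`; the
  transported orientation `μ.comap e` is `± μ`, Hatcher p. 235);
* **translations of `ℝⁿ` have sign `+1`** for every `ℤ`-orientation of `ℝⁿ`
  (`HomologicalOrientation.map_addRight_localClass`): the sign is multiplicative in the
  translation vector and every vector is twice another.

Everything is proved; there are no new definitions and no named facts.

## References

* A. Hatcher, *Algebraic Topology*, CUP 2002, §2.2 p. 134, Thm. 2.20, §3.3 pp. 231–236. [HatcherAT2002]
* G. E. Bredon, *Topology and Geometry*, GTM 139, Springer 1993, IV.7, VI.7. [Bredon1993]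
-/

noncomputable section

open CategoryTheory Set Topology

universe u v

namespace Literature.AlgebraicTopology.SingularHomology

/-! ### Generators of infinite cyclic groups -/

section Generators

variable {N N' : Type*} [AddCommGroup N] [Module ℤ N] [AddCommGroup N'] [Module ℤ N']

/-- In a `ℤ`-line with generator `b` (`e b = 1` for an isomorphism `e : N ≃ ℤ`) every element is
the multiple `(e y) • b` of `b`. [folklore] -/
lemma eq_smul_of_linearEquiv_apply_eq_one {b : N} (e : N ≃ₗ[ℤ] ℤ) (hb : e b = 1) (y : N) :
    y = (e y) • b := by
  apply e.injective
  rw [map_zsmul, hb, smul_eq_mul, mul_one]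

/-- Multiples of a generator of a `ℤ`-line are equal only for equal coefficients. [folklore] -/
lemma int_eq_of_smul_eq_smul {b : N} (e : N ≃ₗ[ℤ] ℤ) (hb : e b = 1) {k l : ℤ}
    (h : k • b = l • b) : k = l := by
  have := congrArg e h
  rwa [map_zsmul, map_zsmul, hb, smul_eq_mul, smul_eq_mul, mul_one, mul_one] at this

/-- Signed multiples `(u : ℤ) • b`, `u = ±1`, of a generator of a `ℤ`-line are equal only for equal
signs. [folklore] -/
lemma units_eq_of_smul_eq_smul {b : N} (hb : ∃ e : N ≃ₗ[ℤ] ℤ, e b = 1) {u v : ℤˣ}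
    (h : (u : ℤ) • b = (v : ℤ) • b) : u = v := by
  obtain ⟨e, he⟩ := hb
  exact Units.ext (int_eq_of_smul_eq_smul e he h)

/-- A generator of a `ℤ`-line is not zero. [folklore] -/
lemma ne_zero_of_linearEquiv_apply_eq_one {b : N} (e : N ≃ₗ[ℤ] ℤ) (hb : e b = 1) : b ≠ 0 := by
  rintro rfl
  rw [map_zero] at hb
  exact zero_ne_one hb

/-- **An isomorphism of infinite cyclic groups sends a generator to `±` a generator**
(Hatcher 2002, §2.2, p. 134: a homomorphism `ℤ → ℤ` "must be multiplication by some integer `d`";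
for an isomorphism `d = ±1`). [cite: HatcherAT2002, §2.2 p. 134] -/
theorem exists_units_smul_eq_of_linearEquiv (φ : N ≃ₗ[ℤ] N') {a : N} {b : N'}
    (ha : ∃ e : N ≃ₗ[ℤ] ℤ, e a = 1) (hb : ∃ e : N' ≃ₗ[ℤ] ℤ, e b = 1) :
    ∃ u : ℤˣ, φ a = (u : ℤ) • b := by
  obtain ⟨ea, hea⟩ := ha
  obtain ⟨eb, heb⟩ := hb
  let f : ℤ ≃ₗ[ℤ] ℤ := (ea.symm.trans φ).trans eb
  have hf : ∀ r, f r = r * f 1 := fun r ↦ by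
    rw [← smul_eq_mul, ← map_zsmul f, smul_eq_mul, mul_one]
  have h1 : f 1 = eb (φ a) := by
    simp only [f, LinearEquiv.trans_apply, ← hea, LinearEquiv.symm_apply_apply]
  have hk : IsUnit (eb (φ a)) := by
    refine IsUnit.of_mul_eq_one (f.symm 1) ?_
    rw [← h1, mul_comm, ← hf, LinearEquiv.apply_symm_apply]
  obtain ⟨u, hu⟩ := hk
  exact ⟨u, by rw [hu]; exact eq_smul_of_linearEquiv_apply_eq_one eb heb _⟩

/-- The image of a generator under an isomorphism of `ℤ`-lines is a generator. [folklore] -/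
lemma exists_linearEquiv_apply_eq_one_of_linearEquiv (φ : N ≃ₗ[ℤ] N') {a : N}
    (ha : ∃ e : N ≃ₗ[ℤ] ℤ, e a = 1) : ∃ e : N' ≃ₗ[ℤ] ℤ, e (φ a) = 1 := by
  obtain ⟨ea, hea⟩ := ha
  exact ⟨φ.symm.trans ea, by simp [hea]⟩

end Generators

/-! ### Push-forward of local homology along open embeddings -/

section OpenEmbedding

/-- An injective map with `f a = b` is a map of pairs `(X, X ∖ a) → (Y, Y ∖ b)`. [folklore] -/
lemma mapsTo_compl_singleton_of_injective {X Y : Type*} {f : X → Y} (hf : Function.Injective f)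
    {a : X} {b : Y} (h : f a = b) : MapsTo f {a}ᶜ {b}ᶜ :=
  fun _ hy hy' => hy (hf ((mem_singleton_iff.1 hy').trans h.symm))

variable (R : Type v) [CommRing R] (M : Type v) [AddCommGroup M] [Module R M]
variable {X Y : Type u} [TopologicalSpace X] [TopologicalSpace Y]

/-- Equal maps of pairs induce equal maps on relative homology (congruence in the map, for any two
proofs of the subspace condition). [folklore] -/
lemma relativeSingularHomology.map_congr_left {A : Set X} {B : Set Y} {f f' : C(X, Y)} (e : f = f')
    (h : MapsTo f A B) (h' : MapsTo f' A B) (n : ℕ) :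
    relativeSingularHomology.map R M f h n = relativeSingularHomology.map R M f' h' n := by
  subst e
  rfl

/-- **Local homology is local: push-forward along an open embedding is an isomorphism**
`Hₖ(X | a; M) ≅ Hₖ(Y | f a; M)` (Hatcher 2002, §3.3, p. 231 with Thm. 2.20): `f` is a homeomorphism
onto its open image followed by the inclusion of an open subspace (excision,
`localHomology.isIso_map_subsetIncl_of_isOpen`). [cite: HatcherAT2002, §3.3 p. 231] -/
theorem localHomology.isIso_map_of_isOpenEmbedding_of_eq [T1Space Y] (f : C(X, Y))
    (hf : IsOpenEmbedding f) (a : X) {b : Y} (hb : f a = b) (k : ℕ) :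
    IsIso (relativeSingularHomology.map R M f
      (mapsTo_compl_singleton_of_injective hf.injective hb) k) := by
  subst hb
  let e : X ≃ₜ ↥(range f) := hf.isEmbedding.toHomeomorph
  have hfac : f = (subsetIncl (range f)).comp (e : C(X, ↥(range f))) := by
    ext x
    rfl
  have he : MapsTo (e : C(X, ↥(range f))) {a}ᶜ {e a}ᶜ :=
    mapsTo_compl_singleton_of_injective e.injective rfl
  have hea : (e a : Y) = f a := rfl
  have hi : MapsTo (subsetIncl (range f)) {e a}ᶜ {f a}ᶜ :=
    mapsTo_compl_singleton_of_injective Subtype.val_injective hea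
  haveI h1 : IsIso (relativeSingularHomology.map R M (e : C(X, ↥(range f))) he k) :=
    (inferInstance : IsIso (localHomology.mapIso R M e a k).hom)
  haveI h2 : IsIso (relativeSingularHomology.map R M (subsetIncl (range f)) hi k) :=
    localHomology.isIso_map_subsetIncl_of_isOpen R M hf.isOpen_range (mem_range_self a) k
  rw [relativeSingularHomology.map_congr_left R M hfac _ (hi.comp he) k,
    relativeSingularHomology.map_comp R M (e : C(X, ↥(range f))) (subsetIncl (range f)) he hi k]
  exact IsIso.comp_isIso

end OpenEmbedding

/-! ### The sign of a self-homeomorphism of a connected oriented manifold -/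

section HomeoSign

variable {n : ℕ} {X : Type u} [TopologicalSpace X]

/-- The sign of a self-homeomorphism is determined by its action at a single point. [folklore] -/
lemma HomologicalOrientation.sign_unique (μ : HomologicalOrientation ℤ X n) {e : X ≃ₜ X} {s t : ℤˣ}
    (hs : ∀ (p q : X) (hq : e p = q),
      relativeSingularHomology.map ℤ ℤ (e : C(X, X))
        (mapsTo_compl_singleton_of_injective e.injective hq) n (μ.localClass p) =
        (s : ℤ) • μ.localClass q)
    {p q : X} (hq : e p = q)
    (ht : relativeSingularHomology.map ℤ ℤ (e : C(X, X))
        (mapsTo_compl_singleton_of_injective e.injective hq) n (μ.localClass p) =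
        (t : ℤ) • μ.localClass q) :
    t = s :=
  units_eq_of_smul_eq_smul (μ.isGenerator q) (ht.symm.trans (hs p q hq))

variable [T2Space X] [ChartedSpace (EuclideanSpace ℝ (Fin n)) X] [ConnectedSpace X]

/-- **The global sign of a self-homeomorphism of a connected `ℤ`-oriented manifold**: there is
`s = ±1` with `e_* μ_p = s • μ_{e p}` for *all* `p` (Hatcher 2002, §3.3, p. 235: the transported
orientation `e^* μ` is an orientation of the connected manifold `X`, hence `= ± μ`,
`HomologicalOrientation.eq_or_eq_neg_of_connected`). [cite: HatcherAT2002, §3.3 p. 235] -/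
theorem HomologicalOrientation.exists_sign_of_homeomorph
    (μ : HomologicalOrientation ℤ X n) (e : X ≃ₜ X) :
    ∃ s : ℤˣ, ∀ (p q : X) (hq : e p = q),
      relativeSingularHomology.map ℤ ℤ (e : C(X, X))
        (mapsTo_compl_singleton_of_injective e.injective hq) n (μ.localClass p) =
        (s : ℤ) • μ.localClass q := by
  rcases HomologicalOrientation.eq_or_eq_neg_of_connected_holds X (μ.comap e) μ with h | h
  · refine ⟨1, fun p q hq => ?_⟩
    subst hq
    have h1 := congrArg (fun ν : HomologicalOrientation ℤ X n => ν.localClass p) h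
    simp only [HomologicalOrientation.comap_localClass] at h1
    have h2 := congrArg (localHomology.mapIso ℤ ℤ e p n).hom h1
    rw [Iso.inv_hom_id_apply] at h2
    rw [Units.val_one, one_zsmul]
    exact h2.symm
  · refine ⟨-1, fun p q hq => ?_⟩
    subst hq
    have h1 := congrArg (fun ν : HomologicalOrientation ℤ X n => ν.localClass p) h
    simp only [HomologicalOrientation.comap_localClass,
      HomologicalOrientation.neg_localClass] at h1
    have h2 := congrArg (localHomology.mapIso ℤ ℤ e p n).hom h1
    rw [Iso.inv_hom_id_apply, map_neg] at h2
    rw [Units.val_neg, Units.val_one, neg_one_zsmul, h2, neg_neg]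
    rfl

end HomeoSign

/-! ### Translations of `ℝⁿ` have sign `+1` -/

section Translation

variable {n : ℕ}

/-- Composition of translations: `(· + b) ∘ (· + a) = (· + (a + b))` as continuous maps.
[folklore] -/
lemma Homeomorph.coe_addRight_comp_addRight {G : Type*} [TopologicalSpace G] [AddGroup G]
    [ContinuousAdd G] (a b : G) :
    ((Homeomorph.addRight b : G ≃ₜ G) : C(G, G)).comp ((Homeomorph.addRight a : G ≃ₜ G) : C(G, G)) =
      ((Homeomorph.addRight (a + b) : G ≃ₜ G) : C(G, G)) := by
  ext v
  simp [add_assoc]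

/-- **Translations preserve every `ℤ`-orientation of `ℝⁿ`**: for the translation `τ_a = (· + a)`
and any `ℤ`-orientation `g` of `ℝⁿ`, `(τ_a)_* g_p = g_{p + a}` (Hatcher 2002, §3.3, p. 236: the
canonical orientation of `ℝⁿ` is translation invariant; here for an arbitrary `g`: the global sign
`s(a)` of `τ_a` is multiplicative, `s(a + b) = s(a) s(b)`, and `a = a/2 + a/2`, so `s(a) = s(a/2)² = 1`).
[cite: HatcherAT2002, §3.3 p. 236] -/
theorem HomologicalOrientation.map_addRight_localClass
    (g : HomologicalOrientation ℤ (EuclideanSpace ℝ (Fin n)) n) (a p q : EuclideanSpace ℝ (Fin n))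
    (hq : p + a = q) :
    relativeSingularHomology.map ℤ ℤ ((Homeomorph.addRight (a) : EuclideanSpace ℝ (Fin n) ≃ₜ EuclideanSpace ℝ (Fin n)) :
          C(EuclideanSpace ℝ (Fin n), EuclideanSpace ℝ (Fin n)))
      (mapsTo_compl_singleton_of_injective (Homeomorph.addRight a).injective hq) n
      (g.localClass p) = g.localClass q := by
  -- the global sign of each translation
  choose s hs using fun b : EuclideanSpace ℝ (Fin n) =>
    g.exists_sign_of_homeomorph (Homeomorph.addRight b)
  -- multiplicativity `s (b + c) = s c * s b`
  have hmul : ∀ b c, s (b + c) = s c * s b := by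
    intro b c
    have hcomp : relativeSingularHomology.map ℤ ℤ ((Homeomorph.addRight (b + c) : EuclideanSpace ℝ (Fin n) ≃ₜ EuclideanSpace ℝ (Fin n)) :
          C(EuclideanSpace ℝ (Fin n), EuclideanSpace ℝ (Fin n)))
        (mapsTo_compl_singleton_of_injective (Homeomorph.addRight (b + c)).injective
          (zero_add (b + c))) n =
        relativeSingularHomology.map ℤ ℤ ((Homeomorph.addRight (b) : EuclideanSpace ℝ (Fin n) ≃ₜ EuclideanSpace ℝ (Fin n)) :
          C(EuclideanSpace ℝ (Fin n), EuclideanSpace ℝ (Fin n)))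
          (mapsTo_compl_singleton_of_injective (Homeomorph.addRight b).injective (zero_add b)) n ≫
        relativeSingularHomology.map ℤ ℤ ((Homeomorph.addRight (c) : EuclideanSpace ℝ (Fin n) ≃ₜ EuclideanSpace ℝ (Fin n)) :
          C(EuclideanSpace ℝ (Fin n), EuclideanSpace ℝ (Fin n)))
          (mapsTo_compl_singleton_of_injective (Homeomorph.addRight c).injective
            (rfl : b + c = b + c)) n := by
      rw [← relativeSingularHomology.map_comp]
      exact relativeSingularHomology.map_congr_left ℤ ℤ
        (Homeomorph.coe_addRight_comp_addRight b c).symm _ _ n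
    have h1 : relativeSingularHomology.map ℤ ℤ ((Homeomorph.addRight (b + c) : EuclideanSpace ℝ (Fin n) ≃ₜ EuclideanSpace ℝ (Fin n)) :
          C(EuclideanSpace ℝ (Fin n), EuclideanSpace ℝ (Fin n)))
        (mapsTo_compl_singleton_of_injective (Homeomorph.addRight (b + c)).injective
          (zero_add (b + c))) n (g.localClass 0) = ((s c * s b : ℤˣ) : ℤ) • g.localClass (b + c) := by
      rw [hcomp, ModuleCat.comp_apply, hs b 0 b (zero_add b), map_zsmul, hs c b (b + c) rfl,
        smul_smul, Units.val_mul, mul_comm]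
    exact (g.sign_unique (hs (b + c)) (zero_add (b + c)) h1).symm
  have hsq : ∀ b, s b = 1 := fun b => by
    have hb : (2⁻¹ : ℝ) • b + (2⁻¹ : ℝ) • b = b := by
      rw [← add_smul]; norm_num
    rw [← hb, hmul, Int.units_mul_self]
  have := hs a p q hq
  rwa [hsq a, Units.val_one, one_zsmul] at this

end Translation

end Literature.AlgebraicTopology.SingularHomology
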